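import Summits.BirchSwinnertonDyer.Rank1Residual.GaloisImage.RamifiedOrdinaryLineTwist
import Summits.BirchSwinnertonDyer.Rank1Residual.X2.TateLineDecomposition
import Summits.BirchSwinnertonDyer.Rank1Residual.AdditivePotMult.PStarTwistModel
import Summits.BirchSwinnertonDyer.Rank1Residual.Additive.GordChiBranchKatoComponent
import HarnessLib

/-!
# Ramified ordinary lines on the (M) rows X4(M) / X3♯(M): the Tate line of the multiplicative
# `p*`-twist model, transported — modulo the PUBLISHED Tate uniformisation; with the INERTIA SHAPE of
# the line (what makes the line-matching clause of a congruence automatic) (cell `b2b-bsdres`, team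
# n1011, seat p07 (gen 4), row TB-ROL FILE B-M; sequel of `GaloisImage/RamifiedOrdinaryLineTwist.lean`)

HONEST FRAMING (cell `b2b-bsdres`, run/shared/lean/b2b/bsd-rank1-residual/, verbatim in every
file): the goal of the cell is to DELETE the COMBINATION-SHAPED residual classes of the
Birch–Swinnerton-Dyer formula for ALL analytic-rank `≤ 1` elliptic curves over `ℚ` — "full BSD
formula for every rank `≤ 1` curve in class `C`" assembled STRICTLY from published theorems — so
that the rank-`≤ 1` remainder becomes exactly the CONSTRUCTION-SHAPED classes, which are TYPED
(missing-input `Prop`s), NOT attempted. This is not "finishing BSD". Team n1011 (RESIDUAL-MAP §I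
N10 / N11 LOWER on the (M) rows; Route G's (M) EPW consumer
`AdditivePotMult/PotMultCongruentPartnerEPW`): research route; labels and marks UNCHANGED; nothing
booked. Theorems only; NO definition; NO new named fact. §2–§4 are CONDITIONAL on the tree's
EXISTING named facts A40 `Silverman1994_thmV53_tateUniformisation` / A41
`Silverman1994_thmV53_corV54_tateUniformisation` (Silverman *ATAEC* V.3.1 / V.5.3 / V.5.4, PUBLISHED;
hypotheses `hT40`, `hT41`, exactly as in every X2 Tate file); nothing else. The (G-ord) half of
TB-ROL is n1011-p10's `Additive/GordRamifiedOrdinaryLine.lean` (p259355); this file is its (M) sibling.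

## What

For `V/ℚ` MULTIPLICATIVE at the odd prime `p`, the Tate datum `C_v(V) = ι⁻¹Φ(μ_{p^∞}) ⊂ V[p^∞]` of
a Tate parametrisation `Φ` (X2's `GreenbergVatsalTateDatum.tateDatum`; Greenberg–Vatsal pp. 14–15:
`C ≅ μ_{p^∞}`, `D = A/C ≅ ℚ_p/ℤ_p(δ)` unramified) has: the inertia group TRIVIAL on the quotient
(`tateDatum_htriv`), `C` divisible with `#C[p] = p` (`tateDatum_plus_divisible`,
`natCard_tateDatum_plus_inf_torsionBy`) — hence non-zero and proper (`#E[p] = p²`, §1) — and inertia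
acting on `C[p] = Φ(μ_p)` through the mod-`p` CYCLOTOMIC character
(`smul_eq_nsmul_of_cyclotomicCharacter_eq`). §2 packages this at a place `v ∋ p` of `ℚ` from the
named facts A40/A41 (split / non-split; the non-split sign is killed on inertia by X2's
`inertia_fix_sqrt_gamma`). For a ramified quadratic twist `C • V^{(c)} = W`, `ord_p c = 1`,
`K = ℚ(θ)`, `θ² = c` — in particular the `p*`-twist model of every potentially multiplicative pair
(`PotMult.exists_mult_pStar_twist_model`) — FILE A's transport `t = twistTransport` (sign `+` on
`galRange K`, `−` off it) yields (§3) a Greenberg local datum `L = twistMap C_v(V) t` on `W[p^∞]` with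
* `EmertonPollackWeston2006.IsRamifiedOrdinaryLine W p L`;
* QUOTIENT SHAPE: for `σ ∈ I_{ℚ_v}`, `res σ • x ∓ x ∈ L.plus` for every `x ∈ W[p^∞]` (sign = the sign of
  `t` at `res σ`: inertia acts on `W[p^∞]/C_W ≅ D ⊗ χ_c` through `χ_c`);
* LINE SHAPE: for `σ ∈ I_{ℚ_v}` with `χ_p(σ) = N` (`N < p`) and `m ∈ L.plus`, `p m = 0`:
  `res σ • m = ±N • m` (inertia acts on `C_W[p] ≅ μ_p ⊗ χ_c` through `ω·χ_c`) —
the two clauses under which ANY `Γ_ℚ`-equivariant `W[p] ≃ W₁[p]` between two such rows respects the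
lines (FILE C). Class level (§4): `PotMult.exists_isRamifiedOrdinaryLine`, `ClassX4M.…`, `ClassX3M.…`
at every odd `p`, `p = 3` included (`ord_v(p*) = 1`: `valuation_pStar`; `K = ℚ(√p*) ⊆ ℚ(ζ_p)`:
`exists_numberField_sq_eq_pStar`). So the per-pair binder `hL : IsRamifiedOrdinaryLine W p L` of the
(M) EPW consumer is a THEOREM modulo A40/A41. This is EPW's `A'_{f̃,a}` with `a = (p−1)/2`, `f̃` the
`p`-new form of `V` (n1011-lit C-audit N1 of cc-typer-1's fact).

References: R. Greenberg, V. Vatsal, Invent. Math. 142 (2000) §2 pp. 14–15; J. H. Silverman, *ATAEC*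
(GTM 151) V.3.1, V.5.2–5.4; M. Emerton, R. Pollack, T. Weston, Invent. Math. 163 (2006) §3.1;
J. H. Silverman, *AEC* 2nd ed. III.6.4, X.5 Cor. 5.4; J.-P. Serre, *Local Fields* IV §4 Prop. 17.
-/

noncomputable section

open scoped Classical NumberField AddSubgroup

universe u

namespace Summit.BirchSwinnertonDyer.Rank1Residual.AdditivePotMult

open NumberField IsDedekindDomain Field WeierstrassCurve
  Literature.NumberTheory.EllipticCurves
  Literature.NumberTheory.EllipticCurves.GreenbergSelmer
  Literature.NumberTheory.EllipticCurves.EmertonPollackWeston2006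
  Literature.NumberTheory.GaloisRepresentations
  Literature.NumberTheory.EllipticCurves.Rank1Residual
  Summit.BirchSwinnertonDyer.Rank1Residual.X2
  Summit.BirchSwinnertonDyer.Rank1Residual.X2.GreenbergVatsalTateDatum
  Summit.BirchSwinnertonDyer.Rank1Residual.X2.GreenbergVatsalTateDatumCofree
  Summit.BirchSwinnertonDyer.Rank1Residual.X2.GreenbergVatsalTateDatumTorsion
  Summit.BirchSwinnertonDyer.Rank1Residual.GaloisImage.RamifiedOrdinaryLineTwist
  Summit.BirchSwinnertonDyer.Rank1Residual.Additive

namespace RamifiedOrdinaryLinePotMult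

/-! ### §0 Transport of the inertia shape along a sign-semilinear isomorphism (generic) -/

section Shape

variable {V W : WeierstrassCurve ℚ} {p : ℕ} {v : HeightOneSpectrum (𝓞 ℚ)}
  (L : LocalDatum ℚ (V.geomPrimaryTorsion p) v) (t : V.geomPrimaryTorsion p ≃+ W.geomPrimaryTorsion p)
  (ht : ∀ g : absoluteGaloisGroup ℚ, (∀ m, t (g • m) = g • t m) ∨ (∀ m, t (g • m) = -(g • t m)))

/-- QUOTIENT SHAPE, `+` branch: if `g` acts trivially on `V[p^∞]/C` and `t` is equivariant at `g`,
then `g` acts trivially on `W[p^∞]/t(C)`. [cite: EmertonPollackWeston2006, §3.1 (eq:ordes) (arXiv:math/0404484 p. 17)] -/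
theorem smul_sub_mem_twistMap_of_pos {g : absoluteGaloisGroup ℚ}
    (hg : ∀ m : V.geomPrimaryTorsion p, g • m - m ∈ L.plus) (hpos : ∀ m, t (g • m) = g • t m)
    (x : W.geomPrimaryTorsion p) : g • x - x ∈ (twistMap L t ht).plus := by
  obtain ⟨m, rfl⟩ : ∃ m, t m = x := ⟨t.symm x, t.apply_symm_apply x⟩
  rw [← hpos m, ← map_sub, apply_mem_twistMap_plus_iff]
  exact hg m

/-- QUOTIENT SHAPE, `−` branch: if `g` acts trivially on `V[p^∞]/C` and `t` is ANTI-equivariant at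
`g`, then `g` acts as `−1` on `W[p^∞]/t(C)`: `g • x + x ∈ t(C)`.
[cite: EmertonPollackWeston2006, §3.1 (eq:ordes) (arXiv:math/0404484 p. 17)] -/
theorem smul_add_mem_twistMap_of_neg {g : absoluteGaloisGroup ℚ}
    (hg : ∀ m : V.geomPrimaryTorsion p, g • m - m ∈ L.plus) (hneg : ∀ m, t (g • m) = -(g • t m))
    (x : W.geomPrimaryTorsion p) : g • x + x ∈ (twistMap L t ht).plus := by
  obtain ⟨m, rfl⟩ : ∃ m, t m = x := ⟨t.symm x, t.apply_symm_apply x⟩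
  have h : g • t m + t m = -t (g • m - m) := by rw [map_sub, hneg m]; abel
  rw [h, neg_mem_iff, apply_mem_twistMap_plus_iff]
  exact hg m

/-- LINE SHAPE, `+` branch: an eigenvector `g • m = N • m` in `C` gives the eigenvector `t m` of
`t(C)` with the same eigenvalue when `t` is equivariant at `g`. [folklore] -/
theorem smul_apply_eq_of_pos {g : absoluteGaloisGroup ℚ} (hpos : ∀ m, t (g • m) = g • t m)
    {m : V.geomPrimaryTorsion p} {N : ℕ} (hm : g • m = N • m) : g • t m = N • t m := by
  rw [← hpos m, hm, map_nsmul]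

/-- LINE SHAPE, `−` branch: `g • m = N • m` in `C` gives `g • t m = −(N • t m)` when `t` is
anti-equivariant at `g`. [folklore] -/
theorem smul_apply_eq_of_neg {g : absoluteGaloisGroup ℚ} (hneg : ∀ m, t (g • m) = -(g • t m))
    {m : V.geomPrimaryTorsion p} {N : ℕ} (hm : g • m = N • m) : g • t m = -(N • t m) := by
  have h : g • t m = -t (g • m) := by rw [hneg m, neg_neg]
  rw [h, hm, map_nsmul]

end Shape

/-! ### §1 A local datum with `#(C ∩ E[p]) = p` is a LINE: non-zero and proper -/

section Card

variable {W : WeierstrassCurve ℚ} {p : ℕ} [hp : Fact p.Prime] {v : HeightOneSpectrum (𝓞 ℚ)}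

/-- `#(C ∩ E[p^∞][p]) = p ⟹ C ≠ 0`. [folklore] -/
theorem plus_ne_bot_of_natCard (N : LocalDatum ℚ (W.geomPrimaryTorsion p) v)
    (h : Nat.card ↥(N.plus ⊓ AddSubgroup.torsionBy (↥(W.geomPrimaryTorsion p)) (p : ℤ)) = p) :
    N.plus ≠ ⊥ := by
  intro hbot
  rw [hbot, bot_inf_eq, AddSubgroup.card_bot] at h
  exact hp.out.one_lt.ne h

/-- `#(C ∩ E[p^∞][p]) = p ⟹ C ≠ E[p^∞]` (`#E[p] = p²`, Silverman *AEC* III.6.4). [cite: SilvermanAEC2009, Cor. III.6.4(b)] -/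
theorem plus_ne_top_of_natCard [W.IsElliptic] (N : LocalDatum ℚ (W.geomPrimaryTorsion p) v)
    (h : Nat.card ↥(N.plus ⊓ AddSubgroup.torsionBy (↥(W.geomPrimaryTorsion p)) (p : ℤ)) = p) :
    N.plus ≠ ⊤ := by
  intro htop
  have hc := TateLineDecomposition.natCard_comap_eq W p N
  rw [htop, AddSubgroup.comap_top, AddSubgroup.card_top, top_inf_eq] at hc
  rw [htop, top_inf_eq] at h
  haveI : CharZero (AlgebraicClosure ℚ) :=
    charZero_of_injective_algebraMap (algebraMap ℚ (AlgebraicClosure ℚ)).injective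
  have hsq : Nat.card (geomTorsion W (p : ℤ)) = p ^ 2 :=
    card_torsionPoints_eq_sq_holds W (AlgebraicClosure ℚ) (Nat.cast_ne_zero.mpr hp.out.ne_zero)
  rw [hc, h] at hsq
  have h1 : p ^ 1 < p ^ 2 := Nat.pow_lt_pow_right hp.out.one_lt one_lt_two
  rw [pow_one] at h1
  exact h1.ne hsq

end Card

/-! ### §2 The Tate datum package at an odd multiplicative `v ∋ p` of `ℚ`, from A40 / A41 -/

section Tate

variable (V : WeierstrassCurve ℚ) [V.IsGloballyMinimal] [V.IsElliptic] (p : ℕ) [hp : Fact p.Prime]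
  {v : HeightOneSpectrum (𝓞 ℚ)}

/-- **The Tate line package** at the place `v ∋ p` (`p` odd) of a globally minimal `V/ℚ`
MULTIPLICATIVE at `p`, granted the PUBLISHED Tate uniformisation (A40 split: Silverman *ATAEC* V.3.1
+ V.5.3; A41 non-split: + Lemma V.5.2 (c), Cor. V.5.4; the non-split sign `χ(σ)` is `+1` on the inertia
group by X2's `inertia_fix_sqrt_gamma`): a Greenberg local datum `N` (`= tateDatum`, `C = ι⁻¹Φ(μ_{p^∞})`)
with (i) the inertia group TRIVIAL on `V[p^∞]/C` (`tateDatum_htriv`), (ii) `C` divisible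
(`tateDatum_plus_divisible`), (iii) `#C[p] = p` (`natCard_tateDatum_plus_inf_torsionBy`), (iv) inertia
acting on `C[p] = Φ(μ_p)` through the mod-`p` CYCLOTOMIC character: `χ_p(σ) = N < p ⟹ res σ • c = N • c`
(`smul_eq_nsmul_of_cyclotomicCharacter_eq`). Greenberg–Vatsal pp. 14–15: "`C ≅ μ_{p^∞}` …
`D = A/C ≅ ℚ_p/ℤ_p(δ)` where `δ` is an unramified character".
[cite: GreenbergVatsal2000, §2 pp. 14–15] [cite: SilvermanATAEC1994, Ch. V Thm. 3.1 (c),(d), Lemma 5.2 (c), Thm. 5.3, Cor. 5.4] -/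
theorem exists_tateDatum_package (hT40 : Silverman1994_thmV53_tateUniformisation.{0})
    (hT41 : Silverman1994_thmV53_corV54_tateUniformisation.{0}) (hp2 : p ≠ 2)
    (hmult : V.HasMultiplicativeReductionAtPrime p) (hpv : ((p : ℕ) : 𝓞 ℚ) ∈ v.asIdeal) :
    ∃ N : LocalDatum ℚ (V.geomPrimaryTorsion p) v,
      (∀ x ∈ inertia v, ∀ m : V.geomPrimaryTorsion p, x • m - m ∈ N.plus) ∧
      (∀ c ∈ N.plus, ∃ c' ∈ N.plus, p • c' = c) ∧
      Nat.card ↥(N.plus ⊓ AddSubgroup.torsionBy (↥(V.geomPrimaryTorsion p)) (p : ℤ)) = p ∧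
      (∀ σ ∈ absInertia (v.adicCompletion ℚ), ∀ k : ℕ, k < p →
        ((GaloisRep.cyclotomicCharacter (v.adicCompletion ℚ) p σ : ℤ_[p]ˣ) : ℤ_[p]) = k →
        ∀ c ∈ N.plus, p • c = 0 → absGaloisRestrict ℚ (v.adicCompletion ℚ) σ • c = k • c) := by
  by_cases hs : V.HasSplitMultiplicativeReductionAtPrime p
  · obtain ⟨q, Φ, hq0, hq1, hsurj, hker, hΦσ, -⟩ :=
      hT40 V v (GreenbergVatsalStrictSelmerMultiplicative.hasSplitMultiplicativeReductionAt_of_mem V p hs hpv)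
    have hker' : ∀ u : (AlgebraicClosure (v.adicCompletion ℚ))ˣ, Φ (Additive.ofMul u) = 0 →
        ∃ a : ℤ, (u : AlgebraicClosure (v.adicCompletion ℚ)) =
          algebraMap (v.adicCompletion ℚ) (AlgebraicClosure (v.adicCompletion ℚ)) q ^ a :=
      fun u h ↦ (hker u).1 h
    have hΦI : ∀ σ ∈ absInertia (v.adicCompletion ℚ), ∀ u : (AlgebraicClosure (v.adicCompletion ℚ))ˣ,
        σ • Φ (Additive.ofMul u) = Φ (Additive.ofMul (Units.map
          (Field.absoluteGaloisGroup.toAlgEquiv (v.adicCompletion ℚ) σ :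
            AlgebraicClosure (v.adicCompletion ℚ) →* AlgebraicClosure (v.adicCompletion ℚ)) u)) :=
      fun σ _ u ↦ hΦσ σ u
    refine ⟨tateDatum V p Φ (fun σ u ↦ Or.inl (hΦσ σ u)), tateDatum_htriv V p Φ _ hsurj hker' hΦI,
      tateDatum_plus_divisible V p Φ _, natCard_tateDatum_plus_inf_torsionBy V p Φ _ hq0 hq1 hker',
      fun σ hσ k hk hχ c hc hpc ↦ ?_⟩
    exact smul_eq_nsmul_of_cyclotomicCharacter_eq V p Φ _ hq0 hq1 hker' hΦI hσ hk hχ c hc hpc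
  · obtain ⟨q, t, Ψ, hq0, hq1, -, ht2, hsurj, hker, hΨσ, -⟩ :=
      hT41 V v (GreenbergVatsalStrictSelmerMultiplicative.hasMultiplicativeReductionAt_of_mem V p hmult hpv)
    have hker' : ∀ u : (AlgebraicClosure (v.adicCompletion ℚ))ˣ, Ψ (Additive.ofMul u) = 0 →
        ∃ a : ℤ, (u : AlgebraicClosure (v.adicCompletion ℚ)) =
          algebraMap (v.adicCompletion ℚ) (AlgebraicClosure (v.adicCompletion ℚ)) q ^ a :=
      fun u h ↦ (hker u).1 h
    have hΨI : ∀ σ ∈ absInertia (v.adicCompletion ℚ), ∀ u : (AlgebraicClosure (v.adicCompletion ℚ))ˣ,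
        σ • Ψ (Additive.ofMul u) = Ψ (Additive.ofMul (Units.map
          (Field.absoluteGaloisGroup.toAlgEquiv (v.adicCompletion ℚ) σ :
            AlgebraicClosure (v.adicCompletion ℚ) →* AlgebraicClosure (v.adicCompletion ℚ)) u)) := by
      intro σ hσ u
      rw [hΨσ σ u, if_pos (GreenbergVatsalTateDatumRat.inertia_fix_sqrt_gamma V hp2 hmult hpv t ht2 σ hσ),
        one_zsmul]
    refine ⟨tateDatum V p Ψ (GreenbergVatsalTateDatumSign.sign_disj V Ψ t hΨσ),
      tateDatum_htriv V p Ψ _ hsurj hker' hΨI, tateDatum_plus_divisible V p Ψ _,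
      natCard_tateDatum_plus_inf_torsionBy V p Ψ _ hq0 hq1 hker', fun σ hσ k hk hχ c hc hpc ↦ ?_⟩
    exact smul_eq_nsmul_of_cyclotomicCharacter_eq V p Ψ _ hq0 hq1 hker' hΨI hσ hk hχ c hc hpc

end Tate

/-! ### §3 The ramified ordinary line of the twist `W ≅ V^{(c)}` of a MULTIPLICATIVE `V`, with its inertia shape -/

section Model

variable (V : WeierstrassCurve ℚ) [V.IsGloballyMinimal] [V.IsElliptic] (K : Type) [Field K]
  [NumberField K] (h2 : Module.finrank ℚ K = 2) {θ : K} {c : ℚ} (hθ : θ ∉ Set.range (algebraMap ℚ K))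
  (hc : θ ^ 2 = algebraMap ℚ K c) (p : ℕ) [hp : Fact p.Prime] {W : WeierstrassCurve ℚ}
  {C : VariableChange ℚ} (hC : C • V.quadraticTwist c = W)

include h2 hθ hc hC in
/-- **TB-ROL, (M) half, WITH THE INERTIA SHAPE — modulo the PUBLISHED Tate uniformisation.**
`C • V^{(c)} = W` with `V` globally minimal, MULTIPLICATIVE at the odd prime `p`, `K = ℚ(θ)`, `θ² = c`,
`ord_v c = 1`: granted A40/A41 there is a Greenberg local datum `L` on `W[p^∞]` at `v` — the Tate line
of `V` transported along FILE A's `twistTransport` — such that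
(1) `EmertonPollackWeston2006.IsRamifiedOrdinaryLine W p L`;
(2) QUOTIENT SHAPE: for `σ` in the local inertia group, `res σ • x − x ∈ L.plus` for all `x` if
`res σ ∈ galRange K` (`χ_c(res σ) = +1`) and `res σ • x + x ∈ L.plus` for all `x` otherwise — the
quotient is `D ⊗ χ_c`, `D` unramified;
(3) LINE SHAPE: for `σ` in the local inertia group with `χ_p(σ) = k < p` and `m ∈ L.plus` with
`p m = 0`, `res σ • m = k • m`, resp. `= −(k • m)` — the line's `p`-torsion is `μ_p ⊗ χ_c`.
EPW's `A'_{f̃,a}`, `a = (p−1)/2`, for the `p`-new member `f̃` attached to `V` (n1011-lit C-audit N1).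
[cite: EmertonPollackWeston2006, §3.1 (eq:ordes) (arXiv:math/0404484 p. 17)] [cite: GreenbergVatsal2000, §2 pp. 14–15]
[cite: SilvermanATAEC1994, Ch. V Thm. 3.1 (c),(d), Thm. 5.3, Cor. 5.4] [cite: SilvermanAEC2009, X.5 Cor. 5.4] -/
theorem exists_isRamifiedOrdinaryLine_shape_of_mult_twist
    (hT40 : Silverman1994_thmV53_tateUniformisation.{0})
    (hT41 : Silverman1994_thmV53_corV54_tateUniformisation.{0}) (hp2 : p ≠ 2)
    (hmult : V.HasMultiplicativeReductionAtPrime p) {v : HeightOneSpectrum (𝓞 ℚ)}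
    (hv : ((p : ℕ) : 𝓞 ℚ) ∈ v.asIdeal) (hval : v.valuation ℚ c = WithZero.exp (-1 : ℤ)) :
    ∃ L : LocalDatum ℚ (W.geomPrimaryTorsion p) v, IsRamifiedOrdinaryLine W p L ∧
      (∀ σ ∈ absInertia (v.adicCompletion ℚ),
        (absGaloisRestrict ℚ (v.adicCompletion ℚ) σ ∈ galRange (K := ℚ) K →
          ∀ x : W.geomPrimaryTorsion p,
            absGaloisRestrict ℚ (v.adicCompletion ℚ) σ • x - x ∈ L.plus) ∧
        (absGaloisRestrict ℚ (v.adicCompletion ℚ) σ ∉ galRange (K := ℚ) K →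
          ∀ x : W.geomPrimaryTorsion p,
            absGaloisRestrict ℚ (v.adicCompletion ℚ) σ • x + x ∈ L.plus)) ∧
      (∀ σ ∈ absInertia (v.adicCompletion ℚ), ∀ k : ℕ, k < p →
        ((GaloisRep.cyclotomicCharacter (v.adicCompletion ℚ) p σ : ℤ_[p]ˣ) : ℤ_[p]) = k →
        ∀ m ∈ L.plus, p • m = 0 →
          (absGaloisRestrict ℚ (v.adicCompletion ℚ) σ ∈ galRange (K := ℚ) K →
            absGaloisRestrict ℚ (v.adicCompletion ℚ) σ • m = k • m) ∧
          (absGaloisRestrict ℚ (v.adicCompletion ℚ) σ ∉ galRange (K := ℚ) K →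
            absGaloisRestrict ℚ (v.adicCompletion ℚ) σ • m = -(k • m))) := by
  obtain ⟨N, htriv, hdiv, hcard, hcyc⟩ := exists_tateDatum_package V p hT40 hT41 hp2 hmult hv
  set t := twistTransport V K hθ hc p hC with ht
  have hsign := twistTransport_sign V K h2 hθ hc p hC
  refine ⟨twistMap N t hsign, ?_, fun σ hσ ↦ ⟨fun hg x ↦ ?_, fun hg x ↦ ?_⟩,
    fun σ hσ k hk hχ m hm hpm ↦ ⟨fun hg ↦ ?_, fun hg ↦ ?_⟩⟩
  · exact isRamifiedOrdinaryLine_twistMap_twistTransport V K h2 hθ hc p hC hp2 hv hval N hdiv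
      (plus_ne_top_of_natCard N hcard) (plus_ne_bot_of_natCard N hcard) htriv
  · exact smul_sub_mem_twistMap_of_pos N t hsign
      (htriv _ (Subgroup.mem_map.2 ⟨σ, hσ, rfl⟩)) (twistTransport_smul_of_mem_galRange V K hθ hc p hC hg) x
  · exact smul_add_mem_twistMap_of_neg N t hsign
      (htriv _ (Subgroup.mem_map.2 ⟨σ, hσ, rfl⟩))
      (twistTransport_smul_of_not_mem_galRange V K h2 hθ hc p hC hg) x
  · -- `m = t c` with `c ∈ C[p]`
    have hcm : t.symm m ∈ N.plus := (mem_twistMap_plus_iff N t hsign m).1 hm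
    have hpc : p • t.symm m = 0 := by rw [← map_nsmul, hpm, map_zero]
    have h := smul_apply_eq_of_pos t (twistTransport_smul_of_mem_galRange V K hθ hc p hC hg)
      (hcyc σ hσ k hk hχ _ hcm hpc)
    rwa [t.apply_symm_apply] at h
  · have hcm : t.symm m ∈ N.plus := (mem_twistMap_plus_iff N t hsign m).1 hm
    have hpc : p • t.symm m = 0 := by rw [← map_nsmul, hpm, map_zero]
    have h := smul_apply_eq_of_neg t (twistTransport_smul_of_not_mem_galRange V K h2 hθ hc p hC hg)
      (hcyc σ hσ k hk hχ _ hcm hpc)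
    rwa [t.apply_symm_apply] at h

include h2 hθ hc hC in
/-- **TB-ROL, (M) half** (existence only): `∃ L, IsRamifiedOrdinaryLine W p L` for the ramified
quadratic twist `C • V^{(c)} = W` of a multiplicative `V`, mod A40/A41.
[cite: EmertonPollackWeston2006, §3.1 (eq:ordes) (arXiv:math/0404484 p. 17)] [cite: SilvermanATAEC1994, Ch. V Thm. 5.3, Cor. 5.4] -/
theorem exists_isRamifiedOrdinaryLine_of_mult_twist
    (hT40 : Silverman1994_thmV53_tateUniformisation.{0})
    (hT41 : Silverman1994_thmV53_corV54_tateUniformisation.{0}) (hp2 : p ≠ 2)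
    (hmult : V.HasMultiplicativeReductionAtPrime p) {v : HeightOneSpectrum (𝓞 ℚ)}
    (hv : ((p : ℕ) : 𝓞 ℚ) ∈ v.asIdeal) (hval : v.valuation ℚ c = WithZero.exp (-1 : ℤ)) :
    ∃ L : LocalDatum ℚ (W.geomPrimaryTorsion p) v, IsRamifiedOrdinaryLine W p L := by
  obtain ⟨L, hL, -, -⟩ :=
    exists_isRamifiedOrdinaryLine_shape_of_mult_twist V K h2 hθ hc p hC hT40 hT41 hp2 hmult hv hval
  exact ⟨L, hL⟩

end Model

/-! ### §4 `ord_v(p*) = 1` and `K = ℚ(√p*)`; the (M) classes -/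

section PStar

variable (p : ℕ) [hp : Fact p.Prime]

/-- `ord_v(p*) = 1` at the place `v ∋ p`: `v((−1)^{⌊p/2⌋} p) = exp(−1)`. [folklore] -/
theorem valuation_pStar (v : HeightOneSpectrum (𝓞 ℚ)) (hpv : ((p : ℕ) : 𝓞 ℚ) ∈ v.asIdeal) :
    v.valuation ℚ ((-1 : ℚ) ^ (p / 2) * p) = WithZero.exp (-1 : ℤ) := by
  have hgen : Rat.HeightOneSpectrum.natGenerator v = p := by
    have h := (Rat.natCast_mem_asIdeal_iff v).1 hpv
    exact (Nat.prime_dvd_prime_iff_eq (Rat.HeightOneSpectrum.prime_natGenerator v) hp.out).1 h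
  rw [Valuation.map_mul, Valuation.map_pow, Valuation.map_neg, Valuation.map_one, one_pow, one_mul,
    ← hgen]
  exact Rat.valuation_natGenerator v

variable {p} in
/-- **`K = ℚ(√p*)` packaged**: for odd `p` a quadratic number field with a chosen `θ`, `θ² = p*`,
`θ ∉ ℚ` (the quadratic subfield of `ℚ(ζ_p)`; the tree's `exists_intermediateField_sq_eq_pStar`).
[folklore] -/
theorem exists_numberField_sq_eq_pStar (hp2 : p ≠ 2) :
    ∃ (K : Type) (_ : Field K) (_ : NumberField K), Module.finrank ℚ K = 2 ∧
      ∃ θ : K, θ ∉ Set.range (algebraMap ℚ K) ∧ θ ^ 2 = algebraMap ℚ K ((-1) ^ (p / 2) * p) := by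
  haveI hcycL : IsCyclotomicExtension {p} ℚ (CyclotomicField p ℚ) := by
    have h : (CyclotomicField.algebra p ℚ : Algebra ℚ (CyclotomicField p ℚ)) =
        DivisionRing.toRatAlgebra := Subsingleton.elim _ _
    exact h ▸ CyclotomicField.isCyclotomicExtension p ℚ
  obtain ⟨K, θ, hK2, hθ, hθ2⟩ := exists_intermediateField_sq_eq_pStar p (CyclotomicField p ℚ) hp2
  haveI : NumberField K := NumberField.of_module_finite ℚ K
  exact ⟨K, inferInstance, inferInstance, hK2, θ, hθ, hθ2⟩

end PStar

end RamifiedOrdinaryLinePotMult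

section Classes

open RamifiedOrdinaryLinePotMult

variable {W : WeierstrassCurve ℚ} [W.IsElliptic] {p : ℕ} [hp : Fact p.Prime]

/-- **pot-mult(p), odd `p`: a ramified ordinary line EXISTS at the place above `p`** (mod A40/A41):
the `p*`-twist model `V` of `E` (`PotMult.exists_mult_pStar_twist_model`: `Mult V p`,
`C • V^{(p*)} = W`) is multiplicative at `p`, `ord_p(p*) = 1`, `K = ℚ(√p*)` — §3 applies.
[cite: EmertonPollackWeston2006, §3.1 (eq:ordes) (arXiv:math/0404484 p. 17)] [cite: SilvermanATAEC1994, Ch. V Thm. 5.3, Cor. 5.4] -/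
theorem PotMult.exists_isRamifiedOrdinaryLine (hT40 : Silverman1994_thmV53_tateUniformisation.{0})
    (hT41 : Silverman1994_thmV53_corV54_tateUniformisation.{0}) (hpm : PotMult W p) (hp2 : p ≠ 2)
    {v : HeightOneSpectrum (𝓞 ℚ)} (hv : ((p : ℕ) : 𝓞 ℚ) ∈ v.asIdeal) :
    ∃ L : LocalDatum ℚ (W.geomPrimaryTorsion p) v, IsRamifiedOrdinaryLine W p L := by
  obtain ⟨V, _, _, C, hV, hC⟩ := hpm.exists_mult_pStar_twist_model hp2
  obtain ⟨K, _, _, hK2, θ, hθ, hθ2⟩ := exists_numberField_sq_eq_pStar hp2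
  exact exists_isRamifiedOrdinaryLine_of_mult_twist V K hK2 hθ hθ2 p hC hT40 hT41 hp2 hV hv
    (valuation_pStar p v hv)

/-- **X4(M), EVERY odd `p` (`p = 3` included): a ramified ordinary line EXISTS** (mod A40/A41) — the
binder `hL : IsRamifiedOrdinaryLine W p L` of `PotMultCongruentPartnerEPW` is inhabited on every X4(M)
row. X4(M) stays CONSTRUCTION-SHAPED; nothing booked. [cite: EmertonPollackWeston2006, §3.1 (eq:ordes) (arXiv:math/0404484 p. 17)] -/
theorem ClassX4M.exists_isRamifiedOrdinaryLine (hT40 : Silverman1994_thmV53_tateUniformisation.{0})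
    (hT41 : Silverman1994_thmV53_corV54_tateUniformisation.{0}) (hX : ClassX4M W p)
    {v : HeightOneSpectrum (𝓞 ℚ)} (hv : ((p : ℕ) : 𝓞 ℚ) ∈ v.asIdeal) :
    ∃ L : LocalDatum ℚ (W.geomPrimaryTorsion p) v, IsRamifiedOrdinaryLine W p L :=
  (ClassX4M.potMult W p hX).exists_isRamifiedOrdinaryLine hT40 hT41 hX.p_ne_two hv

/-- **X3♯(M), odd `p`: a ramified ordinary line EXISTS** (mod A40/A41; reducibility of `E[p]` is
irrelevant to the local construction). [cite: EmertonPollackWeston2006, §3.1 (eq:ordes) (arXiv:math/0404484 p. 17)] -/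
theorem ClassX3M.exists_isRamifiedOrdinaryLine [W.IsGloballyMinimal]
    (hT40 : Silverman1994_thmV53_tateUniformisation.{0})
    (hT41 : Silverman1994_thmV53_corV54_tateUniformisation.{0}) (hX : ClassX3M W p)
    {v : HeightOneSpectrum (𝓞 ℚ)} (hv : ((p : ℕ) : 𝓞 ℚ) ∈ v.asIdeal) :
    ∃ L : LocalDatum ℚ (W.geomPrimaryTorsion p) v, IsRamifiedOrdinaryLine W p L :=
  (ClassX3M.potMult W p hX).exists_isRamifiedOrdinaryLine hT40 hT41 (ClassX3M.p_ne_two W p hX) hv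

end Classes

end Summit.BirchSwinnertonDyer.Rank1Residual.AdditivePotMult

end
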